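import Summits.CriticalPhenomena.PercolationContinuityZ3.Theorems.Transplant.SkelPhiKitsStepI
import HarnessLib

/-!
# D″ L7′ params, part 1 (φ-level, consumer-independent): THE KIT SCALARS OF `signChoice₀` AS FUNCTIONS OF THE STEP-I′ DATA — `Skelφ.Prm.*`:
# the zone scale `Mu := max M₀ n₁`, the kit rectangles `A I := StepI.widths D.Gb D.Fb I (Mu+1)` and radii `Rk I := D.R (amax (A I))`, the clamp
# scale `M := max (Mu+1) (D.Gb (Mu+1)) (D.Fb (Mu+1))` (= slab half-width `ℓs`), the kit depth `Kd`, the seed-slab radius `Rseed`, the shell radius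
# `rs`, the face-count bound `cU` — and the CONSTANTS-ONLY hypotheses of p1-g9's `Skelφ.kitClause_stepI` (SkelPhiKitsStepI:43–77) DISCHARGED for them:
# `hAw hRk hℓs hA hAℓ hK hnA hnM hρK hR'₁ hR'₂ hr₀₁ hr₀₂ hrs₁ hrs₂ hcU` (ledger HOME/prim-bschramm-stmt/SIGN-PARAMS.md §0 (c3)–(c4), §1K)

builds on p205010 (kernel theorem, internal audit signed; external expert review pending) — nothing in this file uses p205010.
Status sentence (coordinator 2026-08-20T04:30Z): "θ(p_c) = 0 on ℤ^d, all d ≥ 2 — kernel-verified (Lean 4/Mathlib, standard axioms); internal adversarial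
audit SIGNED 2026-08-20 04:29Z; external expert review pending."
Lane `prim-bschramm-*`, seat `prim-bschramm-stmt` (gen 9); helper file (`--supports stmt-CriticalPhenomena-4575`).
D″ programme (DPRIME-SCOPE §2 L7′; addendum K typing contract; design amendment v2.1 05:43Z: "kits, zones, `kitCon_stepI` consume `D_k` EXACTLY AS
LANDED" — this file is the `D_k` side and is independent of the unit/route questions U0/U1 of the ledger).  Every definition takes the Step-I′ data
`D : Skelφ.StepI.Data V` and the zone scale `Mu` (and, for the frame-uniform comparison radii, `G φ types`); nothing here depends on the running density.
* §1 `Mu`, `A`, `Rk`, `M`, `Kd`, `Rseed`, `rs`, `cU` (two-scale rectangle kit of `SkelPhiKits`: kit = `R_x(Mu+1)` / `R_y(Mu+1)` behind a seed slab of half-width `M`);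
* §2 the sixteen constants-only binders of `kitClause_stepI` at `(ℓs := M, A, Rk, K := Kd, R' := Rseed, r₀ := rs, rs, cU)`.
[cite: KozmaNitzan2024, §4 Theorem 6 (pp. 25–31): the order of constants; Lemma 10 Steps III–V (pp. 19–22)]
-/

namespace Summit.CriticalPhenomena.PercolationContinuityZ3.Theorems.Transplant

namespace Skelφ

namespace Prm

open Literature.Probability.Percolation Literature.Probability.LatticeModels SimpleGraph
open SkelI (tanOff)
open Literature.Probability.Percolation.KozmaNitzan.Cells (oth)

variable {V : Type}

/-! ## §1 The kit scalars -/

/-- **The zone scale `M_u := max M₀ n₁`** (admissible for the zone list, and `M_u + 1` admissible for both extent lists; DPRIME addendum M.3). [this work] -/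
def Mu (M₀ n₁ : ℕ) : ℕ := max M₀ n₁

/-- `M₀ ≤ M_u`. [folklore] -/
theorem M₀_le_Mu (M₀ n₁ : ℕ) : M₀ ≤ Mu M₀ n₁ := le_max_left _ _

/-- `n₁ ≤ M_u` (so every extent `≥ M_u + 1` is admissible). [folklore] -/
theorem n₁_le_Mu (M₀ n₁ : ℕ) : n₁ ≤ Mu M₀ n₁ := le_max_right _ _

/-- `D.k ≤ M_u` from the Step-I′ fact `D.k < M₀`. [folklore] -/
theorem k_le_Mu {k M₀ : ℕ} (h : k < M₀) (n₁ : ℕ) : k ≤ Mu M₀ n₁ := (Nat.le_of_lt h).trans (M₀_le_Mu M₀ n₁)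

variable (D : StepI.Data V) (Mu : ℕ)

/-- **The kit link extents** `ℓK I := M_u + 1` (both axes). [this work] -/
def ℓK : Fin 2 → ℕ := fun _ => Mu + 1

/-- **The kit rectangle half-widths** `A I := widths D.Gb D.Fb I (M_u + 1)`: `A 0 = (M_u+1, Gb(M_u+1))`, `A 1 = (Fb(M_u+1), M_u+1)`.
[cite: KozmaNitzan2024, §4 p. 16 (the hittable geometry)] -/
def A (I : Fin 2) : Fin 2 → ℕ := StepI.widths D.Gb D.Fb I (Mu + 1)

/-- **The kit rectangle fibre radii** `Rk I := D.R (amax (A I))`. [this work] -/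
def Rk (I : Fin 2) : ℕ := D.R (amax (A D Mu I))

/-- **The clamp scale = seed-slab half-width** `M := max (M_u + 1) (max (Gb (M_u+1)) (Fb (M_u+1)))` (dominates every kit half-width). [this work] -/
def M : ℕ := max (Mu + 1) (max (D.Gb (Mu + 1)) (D.Fb (Mu + 1)))

/-- **The kit depth** `Kd ρz := M + 1 + M + max (max (Rk 0) (Rk 1)) ρz` (`ρz` = the zone radius `ψ M_u + off`; the `K` of `kitClause'`, NOT the cell `K`). [this work] -/
def Kd (ρz : ℕ) : ℕ := M D Mu + 1 + M D Mu + max (max (Rk D Mu 0) (Rk D Mu 1)) ρz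

/-- **The face-count bound** `cU := (Δ+1)^{max Rk}`. [this work] -/
def cU (Δ : ℕ) : ℕ := (Δ + 1) ^ max (Rk D Mu 0) (Rk D Mu 1)

variable (G : SimpleGraph V) [G.LocallyFinite] (φ : V → Site 2) (types : Finset V)

/-- **The seed-slab radius** `Rseed := max (cylRadMax M (M + 2 + 2 T₀)) (max_I (cylRadMax M (M + 2 + A I I + Rk I)))` (frame-uniform comparison radii;
the `R'` of `kitClause'`, NOT the band growth). [this work] -/
noncomputable def Rseed : ℕ :=
  max (cylRadMax G φ types (M D Mu) (M D Mu + 2 + 2 * tanOff (M D Mu) (M D Mu)))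
    (max (cylRadMax G φ types (M D Mu) (M D Mu + 2 + A D Mu 0 0 + Rk D Mu 0))
      (cylRadMax G φ types (M D Mu) (M D Mu + 2 + A D Mu 1 1 + Rk D Mu 1)))

/-- **The shell / near–far radius** `rs ρz := M + 2 + T₀ + max Rseed (Kd ρz)` (serves both `r₀` and `rs` of `kitClause'`). [this work] -/
noncomputable def rs (ρz : ℕ) : ℕ := M D Mu + 2 + tanOff (M D Mu) (M D Mu) + max (Rseed D Mu G φ types) (Kd D Mu ρz)

/-! ## §2 The constants-only binders of `kitClause_stepI` -/

/-- `hAw`: the half-widths are the band widths at the kit extents. [folklore] -/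
theorem hAw (I : Fin 2) : A D Mu I = StepI.widths D.Gb D.Fb I (ℓK Mu I) := rfl

/-- `hRk`: the radii are `D.R (amax (A I))`. [folklore] -/
theorem hRk (I : Fin 2) : Rk D Mu I = D.R (amax (A D Mu I)) := rfl

/-- `hℓK0`/`hℓK1`-shape: the kit extents are `M_u + 1`. [folklore] -/
theorem ℓK_eq (I : Fin 2) : ℓK Mu I = Mu + 1 := rfl

/-- The extent coordinate of a kit rectangle is `M_u + 1`. [folklore] -/
theorem A_self (I : Fin 2) : A D Mu I I = Mu + 1 := by simp [A]

/-- `hℓs : 1 ≤ M` (indeed `M_u + 1 ≤ M`). [folklore] -/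
theorem one_le_M : 1 ≤ M D Mu := le_trans (by omega) (le_max_left _ _)

/-- `hnM : M_u ≤ M` (indeed `M_u + 1 ≤ M`). [folklore] -/
theorem Mu_succ_le_M : Mu + 1 ≤ M D Mu := le_max_left _ _

/-- `hnM`. [folklore] -/
theorem hnM : Mu ≤ M D Mu := le_trans (Nat.le_succ _) (Mu_succ_le_M D Mu)

/-- `hA : A i k ≤ M` for all `i k`. [folklore] -/
theorem hA (i k : Fin 2) : A D Mu i k ≤ M D Mu := by
  unfold A M
  fin_cases i <;> fin_cases k <;> simp [StepI.widths]

/-- `hAℓ : A i (oth i) ≤ ℓs` with `ℓs := M`. [folklore] -/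
theorem hAℓ (i : Fin 2) : A D Mu i (oth i) ≤ M D Mu := hA D Mu i (oth i)

/-- `hnA : M_u + 1 ≤ A i i`. [folklore] -/
theorem hnA (i : Fin 2) : Mu + 1 ≤ A D Mu i i := (A_self D Mu i).ge

/-- `Rk i ≤ max (Rk 0) (Rk 1)`. [folklore] -/
theorem Rk_le_max (i : Fin 2) : Rk D Mu i ≤ max (Rk D Mu 0) (Rk D Mu 1) := by
  fin_cases i
  · exact le_max_left _ _
  · exact le_max_right _ _

/-- `hK : ℓs + 1 + A i i + Rk i ≤ Kd` (`ℓs := M`). [folklore] -/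
theorem hK (ρz : ℕ) (i : Fin 2) : M D Mu + 1 + A D Mu i i + Rk D Mu i ≤ Kd D Mu ρz := by
  have h1 := hA D Mu i i
  have h2 := (Rk_le_max D Mu i).trans (le_max_left (max (Rk D Mu 0) (Rk D Mu 1)) ρz)
  unfold Kd; omega

/-- `hρK : ℓs + 1 + A i i + ρz ≤ Kd ρz`. [folklore] -/
theorem hρK (ρz : ℕ) (i : Fin 2) : M D Mu + 1 + A D Mu i i + ρz ≤ Kd D Mu ρz := by
  have h1 := hA D Mu i i
  have h2 := le_max_right (max (Rk D Mu 0) (Rk D Mu 1)) ρz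
  unfold Kd; omega

/-- `hcU : (Δ+1)^{Rk i} ≤ cU`. [folklore] -/
theorem hcU (Δ : ℕ) (i : Fin 2) : (Δ + 1) ^ Rk D Mu i ≤ cU D Mu Δ :=
  Nat.pow_le_pow_right (Nat.succ_pos Δ) (Rk_le_max D Mu i)

/-- `hR'₁ : cylRadMax ℓs (ℓs + 2 + 2 T₀) ≤ Rseed`. [folklore] -/
theorem hR'₁ : cylRadMax G φ types (M D Mu) (M D Mu + 2 + 2 * tanOff (M D Mu) (M D Mu)) ≤ Rseed D Mu G φ types := le_max_left _ _

/-- `hR'₂ : cylRadMax ℓs (ℓs + 2 + A i i + Rk i) ≤ Rseed`. [folklore] -/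
theorem hR'₂ (i : Fin 2) : cylRadMax G φ types (M D Mu) (M D Mu + 2 + A D Mu i i + Rk D Mu i) ≤ Rseed D Mu G φ types := by
  fin_cases i
  · exact le_trans (le_max_left _ _) (le_max_right _ _)
  · exact le_trans (le_max_right _ _) (le_max_right _ _)

/-- `hr₀₁ : ℓs + 1 + T₀ + Rseed ≤ rs` (with `r₀ := rs`). [folklore] -/
theorem hr₀₁ (ρz : ℕ) : M D Mu + 1 + tanOff (M D Mu) (M D Mu) + Rseed D Mu G φ types ≤ rs D Mu G φ types ρz := by
  have := le_max_left (Rseed D Mu G φ types) (Kd D Mu ρz)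
  unfold rs; omega

/-- `hr₀₂ : ℓs + 2 + T₀ + Kd ≤ rs`. [folklore] -/
theorem hr₀₂ (ρz : ℕ) : M D Mu + 2 + tanOff (M D Mu) (M D Mu) + Kd D Mu ρz ≤ rs D Mu G φ types ρz := by
  have := le_max_right (Rseed D Mu G φ types) (Kd D Mu ρz)
  unfold rs; omega

/-- `hrs₁ : ℓs + 2 + T₀ + Rseed ≤ rs`. [folklore] -/
theorem hrs₁ (ρz : ℕ) : M D Mu + 2 + tanOff (M D Mu) (M D Mu) + Rseed D Mu G φ types ≤ rs D Mu G φ types ρz := by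
  have := le_max_left (Rseed D Mu G φ types) (Kd D Mu ρz)
  unfold rs; omega

/-- `hrs₂ : ℓs + 2 + T₀ + Kd ≤ rs`. [folklore] -/
theorem hrs₂ (ρz : ℕ) : M D Mu + 2 + tanOff (M D Mu) (M D Mu) + Kd D Mu ρz ≤ rs D Mu G φ types ρz := hr₀₂ D Mu G φ types ρz

/-- The clamp offset is `T₀ = 3 M + 2` (`tanOff M M = 2M + 2 + M`). [folklore] -/
theorem tanOff_M : tanOff (M D Mu) (M D Mu) = 3 * M D Mu + 2 := by unfold tanOff; omega

/-- `Rseed ≤ rs`, `Kd ≤ rs` (the shell radius dominates both). [folklore] -/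
theorem Rseed_le_rs (ρz : ℕ) : Rseed D Mu G φ types ≤ rs D Mu G φ types ρz ∧ Kd D Mu ρz ≤ rs D Mu G φ types ρz := by
  have h1 := le_max_left (Rseed D Mu G φ types) (Kd D Mu ρz)
  have h2 := le_max_right (Rseed D Mu G φ types) (Kd D Mu ρz)
  unfold rs; omega

end Prm

end Skelφ

end Summit.CriticalPhenomena.PercolationContinuityZ3.Theorems.Transplant
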